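import Literature.Barriers.RiemannHypothesis.TuranPartialSumsSmoothedLine
import Literature.Barriers.RiemannHypothesis.TuranPartialSumsSmoothedEndgame
import Literature.Barriers.RiemannHypothesis.TuranPartialSumsMontgomeryPerron
import Mathlib.Analysis.SpecialFunctions.Pow.Asymptotics
import HarnessLib

/-!
# Montgomery 1983 "mutatis mutandis" — the two-term model of a smoothed twisted section

Proofs-only companion of `Literature/Barriers/RiemannHypothesis/TuranPartialSums.lean` (named fact
`Literature.Barriers.RiemannHypothesis.montgomery1983_smoothedRemark`, Montgomery 1983, §1 p. 498), on top
of `TuranPartialSumsSmoothedLine.lean`. One definition (the explicit error bound `lineErr` of the line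
integral, a real number), no named facts.

The three smoothed sections `C_N`, `V_N`, `A_N`, twisted by Montgomery's `a(n)`, are all of the form
`F(s) = ρ(s) f(s) + (1/2πi)∫ f(s+w) x^w η̃/w dw + (tails)` (§2 (5) of the source, the kernel `1/w` times
a bounded factor). This file turns the line integral into the model of §4 (24)–(25),
`a₀ q(s) e^{−Λ(s−1)}` with `a₀ = e^{iΛ} Λ^{β−1} g₁(0)/Γ(β)` and `q(s) = η̃(1−t)/(1 + 1/Λ + i − s)`
(`norm_lineIntegral_sub_model_le`), and provides the inputs of the closing argument that do not
depend on the kernel: the size of `f` near `s = 1` (`norm_montgomeryF_near_one`, `f ≍ |s−1|^{−b̂(0)}`,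
Lemma 4 at `k = 0`), the crude bound `|f| ≤ Λ + 1` on the line, the tails of an absolutely convergent
kernel (`norm_integral_sub_intervalIntegral_le`), and the decay of the error:
`lineErr ≤ ε H Λ^{β−1}` for large `Λ` (`eventually_lineErr_le`, using `b̂(1) − b̂(0) > 1`).

## References

* [Montgomery1983] H. L. Montgomery, *Zeros of approximations to the zeta function*, Studies in Pure
  Mathematics (Turán memorial), Birkhäuser 1983, 497–506: §1 p. 498, §4 (20)–(25).
-/

noncomputable section

open Complex Set Filter Topology MeasureTheory intervalIntegral Asymptotics
open scoped Interval

namespace Literature.Barriers.RiemannHypothesis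

section Model

variable (m : ℕ)

/-! ## `f` near `s = 1`: `f(z) ≍ |z − 1|^{−b̂(0)}` (Lemma 4 at `k = 0`) -/

/-- A point `z` with `1 < Re z ≤ 3/2` is `zline Λ' (0 + Im z)` with `1/Λ' = Re z − 1`. [folklore] -/
theorem zline_of_near_one (z : ℂ) :
    zline (1 / (z.re - 1)) ((0 : ℤ) + z.im) = z ∧
      (((1 / (1 / (z.re - 1)) : ℝ) : ℂ) + z.im * I) = z - 1 := by
  constructor
  · apply Complex.ext
    · simp [zline]
    · simp [zline]
  · apply Complex.ext
    · simp
    · simp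

/-- **`|f(z)| ≍ |z−1|^{−b̂(0)}` near `1`** (from (18) at `k = 0`): for `1 < Re z ≤ 3/2`, `|Im z| ≤ 1/2`,
`|z−1|^{−b̂(0)} e^{−G₀} ≤ |f(z)| ≤ |z−1|^{−b̂(0)} e^{G₀}`, `G₀ = A₁ + A₂ log log 5`. [cite: Montgomery1983, Lemma 4 (18)] -/
theorem norm_montgomeryF_near_one {A₁ A₂ : ℝ}
    (h18 : ∀ (k : ℤ) (z : ℂ), 1 < z.re → z.re ≤ 2 → |z.im - k| ≤ 1 / 2 →
      ‖montgomeryPhi m z + (montgomeryCoeff m k : ℂ) * log (z - 1 - k * I)‖ ≤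
        A₁ + A₂ * Real.log (Real.log (|(k : ℝ)| + 5)))
    {z : ℂ} (hz1 : 1 < z.re) (hz2 : z.re ≤ 3 / 2) (hzi : |z.im| ≤ 1 / 2) :
    ‖montgomeryF m z‖ ≤ ‖z - 1‖ ^ (-montgomeryCoeff m 0) * Real.exp (A₁ + A₂ * Real.log (Real.log 5)) ∧
      ‖z - 1‖ ^ (-montgomeryCoeff m 0) * Real.exp (-(A₁ + A₂ * Real.log (Real.log 5))) ≤ ‖montgomeryF m z‖ := by
  have hΛ' : 2 ≤ 1 / (z.re - 1) := by
    rw [le_div_iff₀ (by linarith)]; linarith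
  obtain ⟨hz, hw⟩ := zline_of_near_one z
  have h := norm_montgomeryF_line_le m h18 hΛ' 0 (v := z.im) hzi
  rw [hz, hw, show (|((0 : ℤ) : ℝ)| + 5 : ℝ) = 5 by norm_num] at h
  exact h

/-- **`|f'(z)| ≤ |f(z)| (−b̂(0)/|z−1| + L₀)` near `1`** (from (19) at `k = 0`), `L₀ = A₃ + A₄ log 5`, for
`1 < Re z ≤ 3/2`, `|Im z| ≤ 1/2`. [cite: Montgomery1983, Lemma 4 (19)] -/
theorem norm_deriv_montgomeryF_near_one {A₃ A₄ : ℝ}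
    (h19 : ∀ (k : ℤ) (z : ℂ), 1 < z.re → z.re ≤ 2 → |z.im - k| ≤ 1 / 2 →
      ‖montgomeryPhiDeriv m z + (montgomeryCoeff m k : ℂ) / (z - 1 - k * I)‖ ≤ A₃ + A₄ * Real.log (|(k : ℝ)| + 5))
    {z : ℂ} (hz1 : 1 < z.re) (hz2 : z.re ≤ 3 / 2) (hzi : |z.im| ≤ 1 / 2) :
    ‖deriv (montgomeryF m) z‖ ≤
      ‖montgomeryF m z‖ * ((-montgomeryCoeff m 0) / ‖z - 1‖ + (A₃ + A₄ * Real.log 5)) := by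
  have hΛ' : 2 ≤ 1 / (z.re - 1) := by
    rw [le_div_iff₀ (by linarith)]; linarith
  obtain ⟨hz, hw⟩ := zline_of_near_one z
  have h := norm_deriv_montgomeryF_line_le m h19 hΛ' 0 (v := z.im) hzi
  rw [hz, hw, show (|((0 : ℤ) : ℝ)| + 5 : ℝ) = 5 by norm_num,
    abs_of_neg (montgomeryCoeff_zero_bounds m).2] at h
  exact h

/-! ## The crude bound `|f| ≤ Λ + 1` on the line `Re z = 1 + 1/Λ` -/

/-- `|f(z)| ≤ Λ + 1` on `Re z = 1 + 1/Λ` (`Σ n^{−1−1/Λ} ≤ (1+1/Λ)Λ`). [folklore] -/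
theorem norm_montgomeryF_le_of_re {z : ℂ} {Λ : ℝ} (hΛ : 0 < Λ) (hz : z.re = 1 + 1 / Λ) :
    ‖montgomeryF m z‖ ≤ Λ + 1 := by
  have hρ : 1 < z.re := by rw [hz]; linarith [one_div_pos.2 hΛ]
  have hs : Summable fun n : ℕ ↦ (n : ℝ) ^ (-z.re) := Real.summable_nat_rpow.2 (by linarith)
  have hle : ∀ n : ℕ, ‖LSeries.term (fun n ↦ montgomeryTwist m n) z n‖ ≤ (n : ℝ) ^ (-z.re) :=
    fun n ↦ norm_term_le_rpow (norm_montgomeryTwist_le_one m) z n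
  have hs' : Summable fun n : ℕ ↦ ‖LSeries.term (fun n ↦ montgomeryTwist m n) z n‖ :=
    Summable.of_nonneg_of_le (fun n ↦ norm_nonneg _) hle hs
  rw [montgomeryF, LSeries]
  refine (norm_tsum_le_tsum_norm hs').trans ((hs'.tsum_le_tsum hle hs).trans ?_)
  refine (tsum_nat_rpow_neg_le hρ).trans (le_of_eq ?_)
  rw [hz]; field_simp; ring

/-! ## Tails of an absolutely convergent kernel -/

/-- **Tails.** If `G` is integrable on `ℝ` with `‖G(u)‖ ≤ C/u²` for `|u| ≥ 1`, then for `T₁, T₂ ≥ 1`,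
`‖∫_ℝ G − ∫_{-T₂}^{T₁} G‖ ≤ C/T₁ + C/T₂`. [folklore] -/
theorem norm_integral_sub_intervalIntegral_le {G : ℝ → ℂ} (hG : Integrable G) {C T₁ T₂ : ℝ}
    (hT₁ : 1 ≤ T₁) (hT₂ : 1 ≤ T₂) (hbound : ∀ u : ℝ, 1 ≤ |u| → ‖G u‖ ≤ C / u ^ 2) :
    ‖(∫ u, G u) - ∫ u in (-T₂)..T₁, G u‖ ≤ C / T₁ + C / T₂ := by
  -- splitting `∫_ℝ = ∫_{Iic(-T₂)} + ∫_{-T₂..T₁} + ∫_{Ioi T₁}`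
  have h1 := integral_Iic_add_Ioi (hG.integrableOn (s := Iic T₁)) (hG.integrableOn (s := Ioi T₁))
  have h2 := intervalIntegral.integral_Iic_sub_Iic (hG.integrableOn (s := Iic (-T₂))) (hG.integrableOn (s := Iic T₁))
  have hsplit : (∫ u, G u) - ∫ u in (-T₂)..T₁, G u = (∫ u in Iic (-T₂), G u) + ∫ u in Ioi T₁, G u := by
    rw [← h1, ← h2]; ring
  rw [hsplit]
  -- the integrable majorant `C u^{-2}` on `(T, ∞)`
  have hmaj : ∀ T : ℝ, 1 ≤ T → IntegrableOn (fun u : ℝ ↦ C * u ^ (-2 : ℝ)) (Ioi T) ∧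
      ∫ u in Ioi T, C * u ^ (-2 : ℝ) = C / T := by
    intro T hT
    have hT0 : 0 < T := by linarith
    refine ⟨(integrableOn_Ioi_rpow_of_lt (by norm_num) hT0).const_mul C, ?_⟩
    rw [MeasureTheory.integral_const_mul, integral_Ioi_rpow_of_lt (by norm_num) hT0]
    rw [show (-2 : ℝ) + 1 = -1 by norm_num, Real.rpow_neg_one]
    field_simp
  have hright : ‖∫ u in Ioi T₁, G u‖ ≤ C / T₁ := by
    obtain ⟨hint, hval⟩ := hmaj T₁ hT₁
    rw [← hval]
    refine norm_integral_le_of_norm_le hint ?_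
    refine (ae_restrict_iff' measurableSet_Ioi).2 (Eventually.of_forall fun u hu ↦ ?_)
    have hu1 : 1 ≤ |u| := by rw [abs_of_pos (by linarith [mem_Ioi.1 hu])]; exact hT₁.trans (le_of_lt hu)
    refine (hbound u hu1).trans (le_of_eq ?_)
    rw [show (-2 : ℝ) = -((2 : ℕ) : ℝ) by norm_num, Real.rpow_neg (by linarith [mem_Ioi.1 hu]), Real.rpow_natCast]
    field_simp
  have hleft : ‖∫ u in Iic (-T₂), G u‖ ≤ C / T₂ := by
    obtain ⟨hint, hval⟩ := hmaj T₂ hT₂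
    rw [← integral_comp_neg_Ioi, ← hval]
    refine norm_integral_le_of_norm_le hint ?_
    refine (ae_restrict_iff' measurableSet_Ioi).2 (Eventually.of_forall fun u hu ↦ ?_)
    have hu0 : 0 < u := by linarith [mem_Ioi.1 hu]
    have hu1 : 1 ≤ |(-u)| := by rw [abs_neg, abs_of_pos hu0]; exact hT₂.trans (le_of_lt hu)
    refine (hbound (-u) hu1).trans (le_of_eq ?_)
    rw [show (-2 : ℝ) = -((2 : ℕ) : ℝ) by norm_num, Real.rpow_neg hu0.le, Real.rpow_natCast, neg_sq]
    field_simp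
  calc ‖(∫ u in Iic (-T₂), G u) + ∫ u in Ioi T₁, G u‖ ≤ C / T₂ + C / T₁ :=
        (norm_add_le _ _).trans (add_le_add hleft hright)
    _ = C / T₁ + C / T₂ := add_comm _ _

/-! ## The explicit error of the line integral -/

/-- The explicit bound `Err` of `norm_sum_gpieces_sub_main_le`, as a function of the kernel bound `H`,
`Λ`, `a = |α|/2`, the window `w₀` and the truncation `K₀` (a real number; the constants `A_i` are those
of Lemma 4). [cite: Montgomery1983, §4 (21)–(24)] -/
def lineErr (A₁ A₂ A₃ A₄ H Λ a w₀ : ℝ) (K₀ : ℕ) : ℝ :=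
  Real.exp (A₁ + A₂ * Real.log (Real.log ((K₀ : ℝ) + 5))) * H / Λ *
      (40 * Λ ^ (1 / 3 : ℝ) + 48 * (A₃ + A₄ * Real.log ((K₀ : ℝ) + 5) + 1) + 224) * (2 * (1 + Real.log K₀)) +
    H * (4 * Real.exp (A₁ + A₂ * Real.log (Real.log 5)) * (2 / Λ) ^ (-montgomeryCoeff m 0) / (Λ * a) +
      8 * Real.exp (A₁ + A₂ * Real.log (Real.log 5)) / Λ *
        (Λ ^ (montgomeryCoeff m 0) / a + 2 +
          a ^ (-montgomeryCoeff m 0 - 1) * (3 + 3 / (1 - -montgomeryCoeff m 0)) +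
          (A₃ + A₄ * Real.log 5 + 1) / (-montgomeryCoeff m 0))) +
    16 * Real.exp (A₁ + A₂ * Real.log (Real.log 6)) * H / Λ *
      (2 * w₀ ^ (-montgomeryCoeff m 1) + 3 * (A₃ + A₄ * Real.log 6 + 1) + 14) +
    (H * (16 * (A₃ + A₄ * Real.log 6) + 32) + 16 * H) * Real.exp (A₁ + A₂ * Real.log (Real.log 6)) *
      w₀ ^ (2 - montgomeryCoeff m 1) +
    8 * H * Real.exp (A₁ + A₂ * Real.log (Real.log 6)) * Λ ^ (montgomeryCoeff m 1 - 1) *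
      (Λ * w₀) ^ (-montgomeryCoeff m 1)

section LineModel

variable {A₁ A₂ A₃ A₄ : ℝ}
  (h18 : ∀ (k : ℤ) (z : ℂ), 1 < z.re → z.re ≤ 2 → |z.im - k| ≤ 1 / 2 →
    ‖montgomeryPhi m z + (montgomeryCoeff m k : ℂ) * log (z - 1 - k * I)‖ ≤
      A₁ + A₂ * Real.log (Real.log (|(k : ℝ)| + 5)))
  (h19 : ∀ (k : ℤ) (z : ℂ), 1 < z.re → z.re ≤ 2 → |z.im - k| ≤ 1 / 2 →
    ‖montgomeryPhiDeriv m z + (montgomeryCoeff m k : ℂ) / (z - 1 - k * I)‖ ≤ A₃ + A₄ * Real.log (|(k : ℝ)| + 5))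
include h18 h19

/-- **The line integral is the model term `a₀ q e^{−Λ(s−1)}` up to `(e/2π)·lineErr·e^{−Λ(σ−1)}`.** Let
`x > 1`, `Λ = log x ≥ max(20, L₁²)` (`L₁ = A₃ + A₄ log 6`), `s = σ + it` with `1 + 11/Λ ≤ σ ≤ 3/2`, `|t| ≤ 5/Λ`,
`α = 1 + 1/Λ − σ`, `K₀ ≥ 1`, and a factor `η̃` on `ℝ` with `|η̃|, |η̃'| ≤ H`, `η̃'` continuous. Then with the
pieces `η_k(v) = x^{i(k−t)} η̃(k+v−t)` of `kernel_integral_eq_sum_gpieces`,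
`‖(x^α/2π) Σ_k ∫ h_k η_k e^{iΛv} − a₀ q(s) e^{−Λ(s−1)}‖ ≤ (e/2π) lineErr(H, Λ, |α|/2, Λ^{-1/2}, K₀) e^{−Λ(σ−1)}`,
where `a₀ = e^{iΛ} Λ^{β−1} g₁(0)/Γ(β)` and `q(s) = η̃(1−t)/(1 + 1/Λ + i − s)` ((24): the main term
`D₂ N^{1+i−s} (log N)^{b̂(1)−1}`, here with the kernel factor `η̃` evaluated at the singularity `1 + i`).
[cite: Montgomery1983, §4 (24)] -/
theorem norm_lineIntegral_sub_model_le (hA₂ : 0 ≤ A₂) (hA₃ : 0 ≤ A₃) (hA₄ : 0 ≤ A₄) {x : ℝ} (hx1 : 1 < x)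
    (hΛ20 : 20 ≤ Real.log x) (hΛL : (A₃ + A₄ * Real.log 6) ^ 2 ≤ Real.log x)
    {s : ℂ} (hσ1 : 1 + 11 / Real.log x ≤ s.re) (hσ2 : s.re ≤ 3 / 2) (ht : |s.im| ≤ 5 / Real.log x)
    {ηt ηt' : ℝ → ℂ} {H : ℝ} (hH : 0 ≤ H) (hηd : ∀ u, HasDerivAt ηt (ηt' u) u) (hηc : Continuous ηt')
    (hηb : ∀ u, ‖ηt u‖ ≤ H) (hηb' : ∀ u, ‖ηt' u‖ ≤ H) {K₀ : ℕ} (hK₀ : 1 ≤ K₀) :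
    ‖(((x ^ (1 + 1 / Real.log x - s.re) / (2 * Real.pi) : ℝ) : ℂ) *
        ∑ i ∈ Finset.range (2 * K₀ + 1), ∫ v in (-(1 / 2))..(1 / 2),
          gpiece m (Real.log x) (1 + 1 / Real.log x - s.re) s.im
            (fun v ↦ (x : ℂ) ^ (((((i : ℤ) - K₀ : ℤ) : ℝ) - s.im : ℝ) * I) *
              ηt ((((i : ℤ) - K₀ : ℤ) : ℝ) + v - s.im)) ((i : ℤ) - K₀) v *
            exp (((Real.log x * v : ℝ) : ℂ) * I)) -
      (exp ((Real.log x : ℂ) * I) * ((Real.log x ^ (montgomeryCoeff m 1 - 1) / Real.Gamma (montgomeryCoeff m 1) : ℝ) : ℂ) *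
        gOne m (Real.log x) 0) * (ηt (1 - s.im) / (zline (Real.log x) 1 - s)) *
        exp (-(Real.log x : ℂ) * (s - 1))‖ ≤
      Real.exp 1 / (2 * Real.pi) *
        lineErr m A₁ A₂ A₃ A₄ H (Real.log x) (|1 + 1 / Real.log x - s.re| / 2)
          ((Real.log x) ^ (-(1 / 2 : ℝ))) K₀ * Real.exp (-Real.log x * (s.re - 1)) := by
  set Λ := Real.log x with hΛdef
  have hΛ0 : 0 < Λ := by linarith
  have hΛ2 : 2 ≤ Λ := by linarith
  have hx0 : 0 < x := by linarith
  set σ := s.re with hσ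
  set t := s.im with htdef
  set α : ℝ := 1 + 1 / Λ - σ with hα
  have h11 : 11 / Λ ≤ σ - 1 := by linarith
  have hα_neg : α < 0 := by
    rw [hα]; have : 1 / Λ < 11 / Λ := div_lt_div_of_pos_right (by norm_num) hΛ0; linarith
  have hα0 : α ≠ 0 := hα_neg.ne
  have habsα : |α| = σ - 1 - 1 / Λ := by rw [abs_of_neg hα_neg, hα]; ring
  -- the hypotheses of the line lemma
  have ht4 : |t| ≤ 1 / 4 := ht.trans (by rw [div_le_iff₀ hΛ0]; linarith)
  have htα : |t| ≤ |α| / 2 := by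
    rw [habsα]; refine ht.trans ?_
    have : 5 / Λ = (10 / Λ) / 2 := by ring
    rw [this]; refine div_le_div_of_nonneg_right ?_ zero_le_two
    have : 10 / Λ + 1 / Λ = 11 / Λ := by ring
    linarith
  have ha1 : 1 / Λ ≤ |α| / 2 := by
    rw [habsα, le_div_iff₀ two_pos]
    have : 1 / Λ * 2 + 1 / Λ = 3 / Λ := by ring
    have : 3 / Λ ≤ 11 / Λ := div_le_div_of_nonneg_right (by norm_num) hΛ0.le
    linarith
  have ha2 : |α| / 2 ≤ 1 / 2 := by
    rw [habsα]; have := one_div_pos.2 hΛ0; linarith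
  set w₀ : ℝ := Λ ^ (-(1 / 2 : ℝ)) with hw₀
  have hw₀pos : 0 < w₀ := Real.rpow_pos_of_pos hΛ0 _
  have hsqrt : w₀ = 1 / Real.sqrt Λ := by
    rw [hw₀, Real.rpow_neg hΛ0.le, Real.sqrt_eq_rpow, inv_eq_one_div]
  have hsqrt2 : 2 ≤ Real.sqrt Λ := by
    have h4 : Real.sqrt 4 = 2 := by
      rw [show (4 : ℝ) = 2 ^ 2 by norm_num, Real.sqrt_sq zero_le_two]
    rw [← h4]
    exact Real.sqrt_le_sqrt (by linarith)
  have hsqrtΛ : Real.sqrt Λ ≤ Λ := by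
    have h1 : 1 ≤ Real.sqrt Λ := by linarith
    calc Real.sqrt Λ = Real.sqrt Λ * 1 := (mul_one _).symm
      _ ≤ Real.sqrt Λ * Real.sqrt Λ := mul_le_mul_of_nonneg_left h1 (by linarith)
      _ = Λ := Real.mul_self_sqrt hΛ0.le
  have hw1 : 1 / Λ ≤ w₀ := by
    rw [hsqrt]; exact one_div_le_one_div_of_le (by linarith) hsqrtΛ
  have hw2 : w₀ ≤ 1 / 2 := by
    rw [hsqrt]; exact one_div_le_one_div_of_le two_pos hsqrt2
  have hLw : (A₃ + A₄ * Real.log 6) * w₀ ≤ 1 := by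
    set L₁ := A₃ + A₄ * Real.log 6 with hL₁
    have hL₁0 : 0 ≤ L₁ := add_nonneg hA₃ (mul_nonneg hA₄ (Real.log_nonneg (by norm_num)))
    have hL₁le : L₁ ≤ Real.sqrt Λ := by
      have := Real.sqrt_le_sqrt hΛL
      rwa [Real.sqrt_sq hL₁0] at this
    rw [hsqrt, mul_one_div, div_le_one (by linarith)]
    exact hL₁le
  -- the kernel factors of the pieces
  set η : ℤ → ℝ → ℂ := fun k v ↦ (x : ℂ) ^ ((((k : ℝ)) - t : ℝ) * I) * ηt ((k : ℝ) + v - t) with hηdef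
  set η' : ℤ → ℝ → ℂ := fun k v ↦ (x : ℂ) ^ ((((k : ℝ)) - t : ℝ) * I) * ηt' ((k : ℝ) + v - t) with hη'def
  have hunit : ∀ k : ℤ, ‖(x : ℂ) ^ ((((k : ℝ)) - t : ℝ) * I)‖ = 1 := by
    intro k
    rw [ofReal_cpow_eq_exp hx0, show (Real.log x : ℂ) * ((((k : ℝ) - t : ℝ) : ℂ) * I) =
      ((Real.log x * ((k : ℝ) - t) : ℝ) : ℂ) * I by push_cast; ring, norm_exp_ofReal_mul_I]
  have hηd' : ∀ k, ∀ v ∈ Icc (-(1 / 2) : ℝ) (1 / 2), HasDerivAt (η k) (η' k v) v := by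
    intro k v _
    simp only [hηdef, hη'def]
    have h1 : HasDerivAt (fun v : ℝ ↦ (k : ℝ) + v - t) 1 v := by
      simpa using ((hasDerivAt_id v).const_add (k : ℝ)).sub_const t
    have h2 := (hηd ((k : ℝ) + v - t)).scomp v h1
    simp only [one_smul] at h2
    exact h2.const_mul _
  have hηc' : ∀ k, ContinuousOn (η' k) (Icc (-(1 / 2)) (1 / 2)) := by
    intro k
    simp only [hη'def]
    exact (continuousOn_const.mul ((hηc.comp (by fun_prop)).continuousOn))
  have hηb₁ : ∀ k, ∀ v ∈ Icc (-(1 / 2) : ℝ) (1 / 2), ‖η k v‖ ≤ H := by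
    intro k v _; simp only [hηdef, norm_mul, hunit, one_mul]; exact hηb _
  have hηb₂ : ∀ k, ∀ v ∈ Icc (-(1 / 2) : ℝ) (1 / 2), ‖η' k v‖ ≤ H := by
    intro k v _; simp only [hη'def, norm_mul, hunit, one_mul]; exact hηb' _
  -- the line lemma
  have hmain := norm_sum_gpieces_sub_main_le m h18 h19 hA₂ hA₃ hA₄ hΛ2 hα0 ht4 htα ha1 ha2 hw1 hw2 hLw
    η η' hH hηd' hηc' hηb₁ hηb₂ hK₀
  -- sizes
  set β := montgomeryCoeff m 1 with hβ
  set S : ℂ := ∑ i ∈ Finset.range (2 * K₀ + 1), ∫ v in (-(1 / 2))..(1 / 2),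
    gpiece m Λ α t (η ((i : ℤ) - K₀)) ((i : ℤ) - K₀) v * exp (((Λ * v : ℝ) : ℂ) * I) with hS
  set Main : ℂ := η 1 0 * gOne m Λ 0 / ((α : ℂ) + ((1 - t : ℝ) : ℂ) * I) *
    (((Λ ^ (β - 1) * Real.exp (-1) : ℝ) : ℂ) * ((2 * Real.pi / Real.Gamma β : ℝ) : ℂ)) with hMain
  have hmain' : ‖S - Main‖ ≤ lineErr m A₁ A₂ A₃ A₄ H Λ (|α| / 2) w₀ K₀ := by
    simp only [hS, hMain, lineErr, hβ]; exact hmain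
  -- the scalar `x^α / 2π`
  have hxα : x ^ α = Real.exp 1 * Real.exp (-Λ * (σ - 1)) := by
    rw [Real.rpow_def_of_pos hx0, ← hΛdef, ← Real.exp_add]
    congr 1; rw [hα]; field_simp; ring
  have hscalar_pos : 0 < x ^ α / (2 * Real.pi) := div_pos (Real.rpow_pos_of_pos hx0 _) (by positivity)
  -- `(x^α/2π) · Main = a₀ q e^{-Λ(s-1)}`
  have hd : (α : ℂ) + ((1 - t : ℝ) : ℂ) * I = zline Λ 1 - s := by
    rw [hα, zline, ← re_add_im s, ← hσ, ← htdef]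
    push_cast; ring
  have hη10 : η 1 0 = (x : ℂ) ^ (((1 - t : ℝ) : ℂ) * I) * ηt (1 - t) := by
    simp only [hηdef, Int.cast_one]; norm_num
  have hphase : (((x ^ α / (2 * Real.pi) : ℝ)) : ℂ) * ((x : ℂ) ^ (((1 - t : ℝ) : ℂ) * I)) *
      (((Λ ^ (β - 1) * Real.exp (-1) : ℝ) : ℂ) * ((2 * Real.pi / Real.Gamma β : ℝ) : ℂ)) =
      exp ((Λ : ℂ) * I) * ((Λ ^ (β - 1) / Real.Gamma β : ℝ) : ℂ) * exp (-(Λ : ℂ) * (s - 1)) := by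
    have hπ : (2 * Real.pi : ℂ) ≠ 0 := by exact_mod_cast (mul_ne_zero two_ne_zero Real.pi_ne_zero)
    have h1 : (((x ^ α / (2 * Real.pi) : ℝ)) : ℂ) = exp (((α * Λ : ℝ)) : ℂ) / (2 * Real.pi) := by
      rw [Real.rpow_def_of_pos hx0, ← hΛdef, mul_comm (Real.log x) α]
      push_cast; rfl
    have h2 : (x : ℂ) ^ (((1 - t : ℝ) : ℂ) * I) = exp ((Λ : ℂ) * (((1 - t : ℝ) : ℂ) * I)) := by
      rw [ofReal_cpow_eq_exp hx0, ← hΛdef]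
    have h3 : ((Λ ^ (β - 1) * Real.exp (-1) : ℝ) : ℂ) = ((Λ ^ (β - 1) : ℝ) : ℂ) * exp (-1 : ℂ) := by
      push_cast; rfl
    have h4 : ((2 * Real.pi / Real.Gamma β : ℝ) : ℂ) = (2 * Real.pi : ℂ) / (Real.Gamma β : ℂ) := by push_cast; rfl
    have h5 : ((Λ ^ (β - 1) / Real.Gamma β : ℝ) : ℂ) = ((Λ ^ (β - 1) : ℝ) : ℂ) / (Real.Gamma β : ℂ) := by
      push_cast; rfl
    have hαΛ : α * Λ = Λ + 1 - σ * Λ := by rw [hα]; field_simp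
    have hexp : (((α * Λ : ℝ)) : ℂ) + (Λ : ℂ) * (((1 - t : ℝ) : ℂ) * I) + (-1 : ℂ) =
        (Λ : ℂ) * I + -(Λ : ℂ) * (s - 1) := by
      rw [hαΛ, ← re_add_im s, ← hσ, ← htdef]
      push_cast; ring
    rw [h1, h2, h3, h4, h5]
    calc exp (((α * Λ : ℝ)) : ℂ) / (2 * Real.pi) * exp ((Λ : ℂ) * (((1 - t : ℝ) : ℂ) * I)) *
          (((Λ ^ (β - 1) : ℝ) : ℂ) * exp (-1 : ℂ) * ((2 * Real.pi : ℂ) / (Real.Gamma β : ℂ)))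
        = ((Λ ^ (β - 1) : ℝ) : ℂ) / (Real.Gamma β : ℂ) * ((2 * Real.pi : ℂ) / (2 * Real.pi)) *
            (exp (((α * Λ : ℝ)) : ℂ) * exp ((Λ : ℂ) * (((1 - t : ℝ) : ℂ) * I)) * exp (-1 : ℂ)) := by ring
      _ = ((Λ ^ (β - 1) : ℝ) : ℂ) / (Real.Gamma β : ℂ) * 1 *
            exp ((((α * Λ : ℝ)) : ℂ) + (Λ : ℂ) * (((1 - t : ℝ) : ℂ) * I) + (-1 : ℂ)) := by
          rw [div_self hπ, ← exp_add, ← exp_add]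
      _ = _ := by rw [hexp, exp_add]; ring
  have hmodel : (((x ^ α / (2 * Real.pi) : ℝ)) : ℂ) * Main =
      (exp ((Λ : ℂ) * I) * ((Λ ^ (β - 1) / Real.Gamma β : ℝ) : ℂ) * gOne m Λ 0) *
        (ηt (1 - t) / (zline Λ 1 - s)) * exp (-(Λ : ℂ) * (s - 1)) := by
    rw [hMain, hη10, hd]
    have hz : zline Λ 1 - s ≠ 0 := by
      rw [← hd]; intro h
      have := congrArg Complex.re h; simp at this; exact hα0 this
    calc (((x ^ α / (2 * Real.pi) : ℝ)) : ℂ) * ((x : ℂ) ^ (((1 - t : ℝ) : ℂ) * I) * ηt (1 - t) * gOne m Λ 0 /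
          (zline Λ 1 - s) * (((Λ ^ (β - 1) * Real.exp (-1) : ℝ) : ℂ) * ((2 * Real.pi / Real.Gamma β : ℝ) : ℂ)))
        = ((((x ^ α / (2 * Real.pi) : ℝ)) : ℂ) * ((x : ℂ) ^ (((1 - t : ℝ) : ℂ) * I)) *
            (((Λ ^ (β - 1) * Real.exp (-1) : ℝ) : ℂ) * ((2 * Real.pi / Real.Gamma β : ℝ) : ℂ))) *
            gOne m Λ 0 * (ηt (1 - t) / (zline Λ 1 - s)) := by field_simp
      _ = _ := by rw [hphase]; ring
  -- conclusion
  have hfinal : (((x ^ α / (2 * Real.pi) : ℝ)) : ℂ) * S -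
      (exp ((Λ : ℂ) * I) * ((Λ ^ (β - 1) / Real.Gamma β : ℝ) : ℂ) * gOne m Λ 0) *
        (ηt (1 - t) / (zline Λ 1 - s)) * exp (-(Λ : ℂ) * (s - 1)) =
      (((x ^ α / (2 * Real.pi) : ℝ)) : ℂ) * (S - Main) := by
    rw [mul_sub (((x ^ α / (2 * Real.pi) : ℝ)) : ℂ) S Main, hmodel]
  rw [hfinal, norm_mul, norm_real, Real.norm_eq_abs, abs_of_pos hscalar_pos, hxα]
  calc Real.exp 1 * Real.exp (-Λ * (σ - 1)) / (2 * Real.pi) * ‖S - Main‖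
      ≤ Real.exp 1 * Real.exp (-Λ * (σ - 1)) / (2 * Real.pi) * lineErr m A₁ A₂ A₃ A₄ H Λ (|α| / 2) w₀ K₀ :=
        mul_le_mul_of_nonneg_left hmain' (by positivity)
    _ = _ := by ring

end LineModel

/-! ## The decay of `lineErr` -/

/-- **Polynomial majorant of the error.** For `Λ ≥ 4`, `1/Λ ≤ a`, `1 ≤ K₀ ≤ Λ⁴`, `H ≥ 0` and the
window `w₀ = Λ^{-1/2}`:
`lineErr ≤ H (C₁ (log Λ)^{A₂+2} Λ^{-2/3} + C₂ Λ^{b̂(0)} + C₃ Λ^{-1} + C₄ Λ^{b̂(1)/2 − 1})` with constants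
depending only on `δ` and the `A_i`. [cite: Montgomery1983, §4 (21)–(24)] -/
theorem lineErr_le_poly {A₁ A₂ A₃ A₄ : ℝ} (hA₂ : 0 ≤ A₂) (hA₃ : 0 ≤ A₃) (hA₄ : 0 ≤ A₄) {Λ H a : ℝ}
    {K₀ : ℕ} (hΛ : 4 ≤ Λ) (hH : 0 ≤ H) (ha1 : 1 / Λ ≤ a) (hK₀ : 1 ≤ K₀)
    (hK₀Λ : (K₀ : ℝ) ≤ Λ ^ 4) :
    lineErr m A₁ A₂ A₃ A₄ H Λ a (Λ ^ (-(1 / 2 : ℝ))) K₀ ≤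
      H * (10 * Real.exp A₁ * (6 : ℝ) ^ A₂ * (264 + 48 * (A₃ + 6 * A₄ + 1)) *
              Real.log Λ ^ (A₂ + 2) * Λ ^ (-(2 / 3 : ℝ)) +
            Real.exp (A₁ + A₂ * Real.log (Real.log 5)) * (40 + 24 / (1 - -montgomeryCoeff m 0)) *
              Λ ^ (montgomeryCoeff m 0) +
            (Real.exp (A₁ + A₂ * Real.log (Real.log 5)) * (16 + 8 * (A₃ + A₄ * Real.log 5 + 1) / (-montgomeryCoeff m 0)) +
              16 * Real.exp (A₁ + A₂ * Real.log (Real.log 6)) * (3 * (A₃ + A₄ * Real.log 6) + 17)) * Λ ^ (-1 : ℝ) +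
            Real.exp (A₁ + A₂ * Real.log (Real.log 6)) * (16 * (A₃ + A₄ * Real.log 6) + 88) *
              Λ ^ (montgomeryCoeff m 1 / 2 - 1)) := by
  have hΛ0 : 0 < Λ := by linarith
  have hΛ1 : 1 ≤ Λ := by linarith
  set β := montgomeryCoeff m 1 with hβ
  set γ := -montgomeryCoeff m 0 with hγ
  have hβ0 : 0 < β := by have := (montgomeryCoeff_one_bounds m).1; rw [hβ]; linarith
  have hβ1 : β < 1 := (abs_lt.1 (abs_montgomeryCoeff_lt_one m 1)).2
  have hγ0 : 0 < γ := by rw [hγ]; linarith [(montgomeryCoeff_zero_bounds m).2]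
  have hγ1 : γ < 1 := by rw [hγ]; linarith [(montgomeryCoeff_zero_bounds m).1]
  set M₀ := Real.exp (A₁ + A₂ * Real.log (Real.log 5)) with hM₀
  set M₁ := Real.exp (A₁ + A₂ * Real.log (Real.log 6)) with hM₁
  set L₀ := A₃ + A₄ * Real.log 5 with hL₀
  set L₁ := A₃ + A₄ * Real.log 6 with hL₁
  have hM₀0 : 0 < M₀ := Real.exp_pos _
  have hM₁0 : 0 < M₁ := Real.exp_pos _
  have hL₀0 : 0 ≤ L₀ := add_nonneg hA₃ (mul_nonneg hA₄ (Real.log_nonneg (by norm_num)))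
  have hL₁0 : 0 ≤ L₁ := add_nonneg hA₃ (mul_nonneg hA₄ (Real.log_nonneg (by norm_num)))
  set lg := Real.log Λ with hlg
  have hlg1 : 1 ≤ lg := by
    rw [hlg, ← Real.log_exp 1]
    exact Real.log_le_log (Real.exp_pos 1) (by linarith [Real.exp_one_lt_d9])
  have hlg0 : 0 < lg := by linarith
  have ha0 : 0 < a := (one_div_pos.2 hΛ0).trans_le ha1
  -- rpow identities for the window `w₀ = Λ^{-1/2}`
  set w₀ := Λ ^ (-(1 / 2 : ℝ)) with hw₀
  have hw₀pos : 0 < w₀ := Real.rpow_pos_of_pos hΛ0 _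
  have hw₀β : w₀ ^ (-β) = Λ ^ (β / 2) := by
    rw [hw₀, ← Real.rpow_mul hΛ0.le]; congr 1; ring
  have hw₀2β : w₀ ^ (2 - β) = Λ ^ (β / 2 - 1) := by
    rw [hw₀, ← Real.rpow_mul hΛ0.le]; congr 1; ring
  have hΛhalf : Λ * w₀ = Λ ^ (1 / 2 : ℝ) := by
    calc Λ * w₀ = Λ ^ (1 : ℝ) * Λ ^ (-(1 / 2 : ℝ)) := by rw [Real.rpow_one]
      _ = Λ ^ ((1 : ℝ) + -(1 / 2 : ℝ)) := (Real.rpow_add hΛ0 _ _).symm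
      _ = Λ ^ (1 / 2 : ℝ) := by norm_num
  have hΛw₀ : (Λ * w₀) ^ (-β) = Λ ^ (-(β / 2)) := by
    rw [hΛhalf, ← Real.rpow_mul hΛ0.le]; congr 1; ring
  -- logarithms of `K₀`
  have hK₀pos : (0 : ℝ) < K₀ := by exact_mod_cast hK₀
  have hlogK₀ : Real.log K₀ ≤ 4 * lg := by
    calc Real.log K₀ ≤ Real.log (Λ ^ 4) := Real.log_le_log hK₀pos hK₀Λ
      _ = 4 * lg := by rw [Real.log_pow]; push_cast; ring
  have hlogK₀0 : 0 ≤ Real.log K₀ := Real.log_nonneg (by exact_mod_cast hK₀)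
  have hK5 : (K₀ : ℝ) + 5 ≤ Λ ^ 6 := by
    have h44 : (4 : ℝ) ^ 4 ≤ Λ ^ 4 := pow_le_pow_left₀ (by norm_num) hΛ 4
    have h1 : (5 : ℝ) ≤ Λ ^ 4 := le_trans (by norm_num) h44
    have hsq : (2 : ℝ) ≤ Λ ^ 2 := by nlinarith
    have h2 : Λ ^ 4 + Λ ^ 4 ≤ Λ ^ 6 := by
      have : Λ ^ 4 * 2 ≤ Λ ^ 4 * Λ ^ 2 := mul_le_mul_of_nonneg_left hsq (by positivity)
      calc Λ ^ 4 + Λ ^ 4 = Λ ^ 4 * 2 := by ring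
        _ ≤ Λ ^ 4 * Λ ^ 2 := this
        _ = Λ ^ 6 := by ring
    linarith
  have hlogK5 : Real.log ((K₀ : ℝ) + 5) ≤ 6 * lg := by
    calc Real.log ((K₀ : ℝ) + 5) ≤ Real.log (Λ ^ 6) := Real.log_le_log (by positivity) hK5
      _ = 6 * lg := by rw [Real.log_pow]; push_cast; ring
  have hlogK5_1 : 1 ≤ Real.log ((K₀ : ℝ) + 5) := by
    rw [← Real.log_exp 1]
    refine Real.log_le_log (Real.exp_pos 1) ?_
    have : (1 : ℝ) ≤ K₀ := by exact_mod_cast hK₀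
    linarith [Real.exp_one_lt_d9]
  have hlogK5_0 : 0 < Real.log ((K₀ : ℝ) + 5) := by linarith
  -- T1
  have hT1 : Real.exp (A₁ + A₂ * Real.log (Real.log ((K₀ : ℝ) + 5))) * H / Λ *
      (40 * Λ ^ (1 / 3 : ℝ) + 48 * (A₃ + A₄ * Real.log ((K₀ : ℝ) + 5) + 1) + 224) * (2 * (1 + Real.log K₀)) ≤
      H * (10 * Real.exp A₁ * (6 : ℝ) ^ A₂ * (264 + 48 * (A₃ + 6 * A₄ + 1)) * lg ^ (A₂ + 2) * Λ ^ (-(2 / 3 : ℝ))) := by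
    have hE : Real.exp (A₁ + A₂ * Real.log (Real.log ((K₀ : ℝ) + 5))) ≤ Real.exp A₁ * (6 : ℝ) ^ A₂ * lg ^ A₂ := by
      rw [Real.exp_add, mul_comm A₂, Real.exp_mul, Real.exp_log hlogK5_0, mul_assoc]
      refine mul_le_mul_of_nonneg_left ?_ (Real.exp_pos _).le
      rw [← Real.mul_rpow (by norm_num) hlg0.le]
      exact Real.rpow_le_rpow hlogK5_0.le hlogK5 hA₂
    have hcube : 1 ≤ Λ ^ (1 / 3 : ℝ) := Real.one_le_rpow hΛ1 (by norm_num)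
    have hinner : 40 * Λ ^ (1 / 3 : ℝ) + 48 * (A₃ + A₄ * Real.log ((K₀ : ℝ) + 5) + 1) + 224 ≤
        (264 + 48 * (A₃ + 6 * A₄ + 1)) * (Λ ^ (1 / 3 : ℝ) * lg) := by
      set P := Λ ^ (1 / 3 : ℝ) * lg with hP
      have h1 : 1 ≤ P := one_le_mul_of_one_le_of_one_le hcube hlg1
      have h2 : A₄ * Real.log ((K₀ : ℝ) + 5) ≤ 6 * A₄ * P := by
        calc A₄ * Real.log ((K₀ : ℝ) + 5) ≤ A₄ * (6 * lg) := mul_le_mul_of_nonneg_left hlogK5 hA₄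
          _ = 6 * A₄ * (1 * lg) := by ring
          _ ≤ 6 * A₄ * (Λ ^ (1 / 3 : ℝ) * lg) :=
              mul_le_mul_of_nonneg_left (mul_le_mul_of_nonneg_right hcube hlg0.le) (by positivity)
      have h3 : Λ ^ (1 / 3 : ℝ) ≤ P := by
        rw [hP]; exact le_mul_of_one_le_right (by positivity) hlg1
      have h4 : A₃ ≤ A₃ * P := le_mul_of_one_le_right hA₃ h1
      have h5 : (48 : ℝ) ≤ 48 * P := le_mul_of_one_le_right (by norm_num) h1
      have h6 : (224 : ℝ) ≤ 224 * P := le_mul_of_one_le_right (by norm_num) h1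
      have h7 : 40 * Λ ^ (1 / 3 : ℝ) ≤ 40 * P := mul_le_mul_of_nonneg_left h3 (by norm_num)
      calc 40 * Λ ^ (1 / 3 : ℝ) + 48 * (A₃ + A₄ * Real.log ((K₀ : ℝ) + 5) + 1) + 224
          ≤ 40 * P + (48 * (A₃ * P) + 48 * (6 * A₄ * P) + 48 * P) + 224 * P := by linarith
        _ = (264 + 48 * (A₃ + 6 * A₄ + 1)) * P := by ring
    have hlog2 : 2 * (1 + Real.log K₀) ≤ 10 * lg := by linarith
    have hpow : lg ^ A₂ * lg * lg = lg ^ (A₂ + 2) := by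
      rw [Real.rpow_add hlg0, Real.rpow_two]; ring
    have hΛ13 : Λ ^ (1 / 3 : ℝ) / Λ = Λ ^ (-(2 / 3 : ℝ)) := by
      rw [div_eq_mul_inv, ← Real.rpow_neg_one, ← Real.rpow_add hΛ0]; norm_num
    calc Real.exp (A₁ + A₂ * Real.log (Real.log ((K₀ : ℝ) + 5))) * H / Λ *
          (40 * Λ ^ (1 / 3 : ℝ) + 48 * (A₃ + A₄ * Real.log ((K₀ : ℝ) + 5) + 1) + 224) * (2 * (1 + Real.log K₀))
        ≤ (Real.exp A₁ * (6 : ℝ) ^ A₂ * lg ^ A₂) * H / Λ *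
            ((264 + 48 * (A₃ + 6 * A₄ + 1)) * (Λ ^ (1 / 3 : ℝ) * lg)) * (10 * lg) := by
          gcongr
      _ = H * (10 * Real.exp A₁ * (6 : ℝ) ^ A₂ * (264 + 48 * (A₃ + 6 * A₄ + 1)) * (lg ^ A₂ * lg * lg) *
            (Λ ^ (1 / 3 : ℝ) / Λ)) := by ring
      _ = _ := by rw [hpow, hΛ13]
  -- T2
  have hb : montgomeryCoeff m 0 = -γ := by rw [hγ, neg_neg]
  have hT2 : H * (4 * M₀ * (2 / Λ) ^ (-montgomeryCoeff m 0) / (Λ * a) + 8 * M₀ / Λ *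
      (Λ ^ (montgomeryCoeff m 0) / a + 2 + a ^ (-montgomeryCoeff m 0 - 1) * (3 + 3 / (1 - -montgomeryCoeff m 0)) +
        (L₀ + 1) / (-montgomeryCoeff m 0))) ≤
      H * (M₀ * (40 + 24 / (1 - γ)) * Λ ^ (-γ) + M₀ * (16 + 8 * (L₀ + 1) / γ) * Λ ^ (-1 : ℝ)) := by
    rw [hb, neg_neg]
    refine mul_le_mul_of_nonneg_left ?_ hH
    have hΛa : 1 ≤ Λ * a := by
      have := mul_le_mul_of_nonneg_left ha1 hΛ0.le; rwa [mul_one_div_cancel hΛ0.ne'] at this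
    have h22 : (2 : ℝ) ^ γ ≤ 2 := by
      calc (2 : ℝ) ^ γ ≤ (2 : ℝ) ^ (1 : ℝ) := Real.rpow_le_rpow_of_exponent_le one_le_two hγ1.le
        _ = 2 := Real.rpow_one _
    have h1 : (2 / Λ) ^ γ ≤ 2 * Λ ^ (-γ) := by
      rw [Real.div_rpow zero_le_two hΛ0.le, Real.rpow_neg hΛ0.le γ, div_eq_mul_inv]
      exact mul_le_mul_of_nonneg_right h22 (inv_nonneg.2 (Real.rpow_nonneg hΛ0.le γ))
    have h2 : 4 * M₀ * (2 / Λ) ^ γ / (Λ * a) ≤ 8 * M₀ * Λ ^ (-γ) := by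
      rw [div_le_iff₀ (by positivity)]
      calc 4 * M₀ * (2 / Λ) ^ γ ≤ 4 * M₀ * (2 * Λ ^ (-γ)) := mul_le_mul_of_nonneg_left h1 (by positivity)
        _ = 8 * M₀ * Λ ^ (-γ) * 1 := by ring
        _ ≤ 8 * M₀ * Λ ^ (-γ) * (Λ * a) := mul_le_mul_of_nonneg_left hΛa (by positivity)
    have h3 : Λ ^ (-γ) / a ≤ Λ ^ (-γ) * Λ := by
      rw [div_le_iff₀ ha0]
      calc Λ ^ (-γ) = Λ ^ (-γ) * 1 := (mul_one _).symm
        _ ≤ Λ ^ (-γ) * (Λ * a) := mul_le_mul_of_nonneg_left hΛa (by positivity)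
        _ = Λ ^ (-γ) * Λ * a := by ring
    have h4 : a ^ (γ - 1) ≤ Λ ^ (1 - γ) := by
      calc a ^ (γ - 1) ≤ (1 / Λ) ^ (γ - 1) := Real.rpow_le_rpow_of_nonpos (one_div_pos.2 hΛ0) ha1 (by linarith)
        _ = Λ ^ (1 - γ) := by
            rw [Real.div_rpow zero_le_one hΛ0.le, Real.one_rpow, one_div, ← Real.rpow_neg hΛ0.le, neg_sub]
    have h5 : Λ ^ (1 - γ) = Λ ^ (-γ) * Λ := by
      rw [show 1 - γ = -γ + 1 by ring, Real.rpow_add hΛ0, Real.rpow_one]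
    have h6 : 0 < 3 + 3 / (1 - γ) := by
      have : 0 < 1 - γ := by linarith
      have : 0 < 3 / (1 - γ) := div_pos three_pos this
      linarith
    have hΛinv : 1 / Λ = Λ ^ (-1 : ℝ) := by rw [Real.rpow_neg_one, one_div]
    have h4' : a ^ (γ - 1) ≤ Λ ^ (-γ) * Λ := h5 ▸ h4
    calc 4 * M₀ * (2 / Λ) ^ γ / (Λ * a) + 8 * M₀ / Λ * (Λ ^ (-γ) / a + 2 + a ^ (γ - 1) * (3 + 3 / (1 - γ)) + (L₀ + 1) / γ)
        ≤ 8 * M₀ * Λ ^ (-γ) + 8 * M₀ / Λ * (Λ ^ (-γ) * Λ + 2 + Λ ^ (-γ) * Λ * (3 + 3 / (1 - γ)) + (L₀ + 1) / γ) := by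
          refine add_le_add h2 (mul_le_mul_of_nonneg_left ?_ (by positivity))
          exact add_le_add (add_le_add (add_le_add h3 le_rfl) (mul_le_mul_of_nonneg_right h4' h6.le)) le_rfl
      _ = M₀ * (40 + 24 / (1 - γ)) * Λ ^ (-γ) + M₀ * (16 + 8 * (L₀ + 1) / γ) * (1 / Λ) := by
          field_simp; ring
      _ = _ := by rw [hΛinv]
  -- T3
  have hT3 : 16 * M₁ * H / Λ * (2 * w₀ ^ (-β) + 3 * (L₁ + 1) + 14) =
      H * (32 * M₁ * Λ ^ (β / 2 - 1) + 16 * M₁ * (3 * L₁ + 17) * Λ ^ (-1 : ℝ)) := by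
    rw [hw₀β, show β / 2 - 1 = β / 2 + (-1 : ℝ) by ring, Real.rpow_add hΛ0, Real.rpow_neg_one]
    field_simp; ring
  -- T4
  have hT4 : (H * (16 * L₁ + 32) + 16 * H) * M₁ * w₀ ^ (2 - β) = H * (M₁ * (16 * L₁ + 48) * Λ ^ (β / 2 - 1)) := by
    rw [hw₀2β]; ring
  -- T5
  have hT5 : 8 * H * M₁ * Λ ^ (β - 1) * (Λ * w₀) ^ (-β) = H * (8 * M₁ * Λ ^ (β / 2 - 1)) := by
    rw [hΛw₀, show 8 * H * M₁ * Λ ^ (β - 1) * Λ ^ (-(β / 2)) = 8 * H * M₁ * (Λ ^ (β - 1) * Λ ^ (-(β / 2))) by ring,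
      ← Real.rpow_add hΛ0, show β - 1 + -(β / 2) = β / 2 - 1 by ring]; ring
  -- assemble
  simp only [lineErr]
  rw [← hM₀, ← hM₁]
  rw [hb, neg_neg] at hT2 ⊢
  linarith [hT1, hT2, hT3.le, hT4.le, hT5.le]

/-- **The error of the line integral is `o(H Λ^{b̂(1)−1})`** — the comparison with the main term of
(24); this is where `b̂(1) − b̂(0) − 1 > 0` (the mechanism `∫₀¹|e(ϑ)−1|dϑ = 4/π > 1` of §2 (8)) enters, through
the piece `k = 0`: for every `ε > 0` and all large `Λ`, uniformly in `H ≥ 0`, `1/Λ ≤ a`,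
`1 ≤ K₀ ≤ Λ⁴`: `lineErr(H, Λ, a, Λ^{-1/2}, K₀) ≤ ε H Λ^{b̂(1)−1}`. [cite: Montgomery1983, §4 (24)–(25)] -/
theorem eventually_lineErr_le {A₁ A₂ A₃ A₄ : ℝ} (hA₂ : 0 ≤ A₂) (hA₃ : 0 ≤ A₃) (hA₄ : 0 ≤ A₄)
    (hc : 0 < montgomeryCoeff m 1 - montgomeryCoeff m 0 - 1) {ε : ℝ} (hε : 0 < ε) :
    ∀ᶠ Λ : ℝ in atTop, ∀ (H a : ℝ) (K₀ : ℕ), 0 ≤ H → 1 / Λ ≤ a → 1 ≤ K₀ → (K₀ : ℝ) ≤ Λ ^ 4 →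
      lineErr m A₁ A₂ A₃ A₄ H Λ a (Λ ^ (-(1 / 2 : ℝ))) K₀ ≤ ε * H * Λ ^ (montgomeryCoeff m 1 - 1) := by
  set β := montgomeryCoeff m 1 with hβ
  set γ := -montgomeryCoeff m 0 with hγ
  have hβ0 : 1 / 2 ≤ β := by have := (montgomeryCoeff_one_bounds m).1; rw [hβ]; linarith
  have hγβ : 0 < β + γ - 1 := by rw [hβ, hγ]; linarith
  set C₁ : ℝ := 10 * Real.exp A₁ * (6 : ℝ) ^ A₂ * (264 + 48 * (A₃ + 6 * A₄ + 1)) with hC₁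
  set C₂ : ℝ := Real.exp (A₁ + A₂ * Real.log (Real.log 5)) * (40 + 24 / (1 - -montgomeryCoeff m 0)) with hC₂
  set C₃ : ℝ := Real.exp (A₁ + A₂ * Real.log (Real.log 5)) *
      (16 + 8 * (A₃ + A₄ * Real.log 5 + 1) / (-montgomeryCoeff m 0)) +
    16 * Real.exp (A₁ + A₂ * Real.log (Real.log 6)) * (3 * (A₃ + A₄ * Real.log 6) + 17) with hC₃
  set C₄ : ℝ := Real.exp (A₁ + A₂ * Real.log (Real.log 6)) * (16 * (A₃ + A₄ * Real.log 6) + 88) with hC₄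
  have hC₁0 : 0 ≤ C₁ := by rw [hC₁]; positivity
  -- (1) the logarithmic term
  have e1 : ∀ᶠ Λ : ℝ in atTop, C₁ * Real.log Λ ^ (A₂ + 2) ≤ ε / 4 * Λ ^ (β - 1 / 3) := by
    have hlo := (isLittleO_log_rpow_rpow_atTop (A₂ + 2) (show 0 < β - 1 / 3 by linarith)).def
      (show 0 < ε / 4 / (C₁ + 1) by positivity)
    filter_upwards [hlo, eventually_ge_atTop 1] with Λ hΛ hΛ1
    rw [Real.norm_eq_abs, Real.norm_eq_abs, abs_of_nonneg (Real.rpow_nonneg (Real.log_nonneg hΛ1) _),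
      abs_of_nonneg (Real.rpow_nonneg (by linarith) _)] at hΛ
    have hpos : 0 ≤ Λ ^ (β - 1 / 3) := Real.rpow_nonneg (by linarith) _
    calc C₁ * Real.log Λ ^ (A₂ + 2) ≤ (C₁ + 1) * (ε / 4 / (C₁ + 1) * Λ ^ (β - 1 / 3)) :=
          mul_le_mul (by linarith) hΛ (Real.rpow_nonneg (Real.log_nonneg hΛ1) _) (by linarith)
      _ = ε / 4 * Λ ^ (β - 1 / 3) := by field_simp
  -- (2)–(4) the power terms
  have epow : ∀ {C p : ℝ}, 0 < p → ∀ᶠ Λ : ℝ in atTop, C ≤ ε / 4 * Λ ^ p := by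
    intro C p hp
    have h := (tendsto_rpow_atTop hp).eventually_ge_atTop (C * (4 / ε))
    filter_upwards [h] with Λ hΛ
    calc C = C * (4 / ε) * (ε / 4) := by field_simp
      _ ≤ Λ ^ p * (ε / 4) := mul_le_mul_of_nonneg_right hΛ (by positivity)
      _ = ε / 4 * Λ ^ p := mul_comm _ _
  have e2 : ∀ᶠ Λ : ℝ in atTop, C₂ ≤ ε / 4 * Λ ^ (β + γ - 1) := epow hγβ
  have e3 : ∀ᶠ Λ : ℝ in atTop, C₃ ≤ ε / 4 * Λ ^ β := epow (by linarith)
  have e4 : ∀ᶠ Λ : ℝ in atTop, C₄ ≤ ε / 4 * Λ ^ (β / 2) := epow (by linarith)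
  filter_upwards [e1, e2, e3, e4, eventually_ge_atTop (4 : ℝ)] with Λ h1 h2 h3 h4 hΛ4
  intro H a K₀ hH ha1 hK₀ hK₀Λ
  have hΛ0 : 0 < Λ := by linarith
  refine (lineErr_le_poly m hA₂ hA₃ hA₄ hΛ4 hH ha1 hK₀ hK₀Λ).trans ?_
  rw [← hC₁, ← hC₂, ← hC₃, ← hC₄, ← hβ]
  have t1 : C₁ * Real.log Λ ^ (A₂ + 2) * Λ ^ (-(2 / 3 : ℝ)) ≤ ε / 4 * Λ ^ (β - 1) := by
    calc C₁ * Real.log Λ ^ (A₂ + 2) * Λ ^ (-(2 / 3 : ℝ)) ≤ (ε / 4 * Λ ^ (β - 1 / 3)) * Λ ^ (-(2 / 3 : ℝ)) :=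
          mul_le_mul_of_nonneg_right h1 (Real.rpow_nonneg hΛ0.le _)
      _ = ε / 4 * Λ ^ (β - 1) := by
          rw [mul_assoc, ← Real.rpow_add hΛ0]; ring_nf
  have t2 : C₂ * Λ ^ (montgomeryCoeff m 0) ≤ ε / 4 * Λ ^ (β - 1) := by
    calc C₂ * Λ ^ (montgomeryCoeff m 0) ≤ (ε / 4 * Λ ^ (β + γ - 1)) * Λ ^ (montgomeryCoeff m 0) :=
          mul_le_mul_of_nonneg_right h2 (Real.rpow_nonneg hΛ0.le _)
      _ = ε / 4 * Λ ^ (β - 1) := by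
          rw [mul_assoc, ← Real.rpow_add hΛ0, hγ]; ring_nf
  have t3 : C₃ * Λ ^ (-1 : ℝ) ≤ ε / 4 * Λ ^ (β - 1) := by
    calc C₃ * Λ ^ (-1 : ℝ) ≤ (ε / 4 * Λ ^ β) * Λ ^ (-1 : ℝ) :=
          mul_le_mul_of_nonneg_right h3 (Real.rpow_nonneg hΛ0.le _)
      _ = ε / 4 * Λ ^ (β - 1) := by
          rw [mul_assoc, ← Real.rpow_add hΛ0]; ring_nf
  have t4 : C₄ * Λ ^ (β / 2 - 1) ≤ ε / 4 * Λ ^ (β - 1) := by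
    calc C₄ * Λ ^ (β / 2 - 1) ≤ (ε / 4 * Λ ^ (β / 2)) * Λ ^ (β / 2 - 1) :=
          mul_le_mul_of_nonneg_right h4 (Real.rpow_nonneg hΛ0.le _)
      _ = ε / 4 * Λ ^ (β - 1) := by
          rw [mul_assoc, ← Real.rpow_add hΛ0]; ring_nf
  calc H * (C₁ * Real.log Λ ^ (A₂ + 2) * Λ ^ (-(2 / 3 : ℝ)) + C₂ * Λ ^ (montgomeryCoeff m 0) +
        C₃ * Λ ^ (-1 : ℝ) + C₄ * Λ ^ (β / 2 - 1))
      ≤ H * (ε / 4 * Λ ^ (β - 1) + ε / 4 * Λ ^ (β - 1) + ε / 4 * Λ ^ (β - 1) + ε / 4 * Λ ^ (β - 1)) :=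
        mul_le_mul_of_nonneg_left (add_le_add (add_le_add (add_le_add t1 t2) t3) t4) hH
    _ = ε * H * Λ ^ (β - 1) := by ring

/-! ## The kernel-independent inputs of the closing argument -/

section Box

variable {A₁ A₂ A₃ A₄ : ℝ}
  (h18 : ∀ (k : ℤ) (z : ℂ), 1 < z.re → z.re ≤ 2 → |z.im - k| ≤ 1 / 2 →
    ‖montgomeryPhi m z + (montgomeryCoeff m k : ℂ) * log (z - 1 - k * I)‖ ≤
      A₁ + A₂ * Real.log (Real.log (|(k : ℝ)| + 5)))
  (h19 : ∀ (k : ℤ) (z : ℂ), 1 < z.re → z.re ≤ 2 → |z.im - k| ≤ 1 / 2 →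
    ‖montgomeryPhiDeriv m z + (montgomeryCoeff m k : ℂ) / (z - 1 - k * I)‖ ≤ A₃ + A₄ * Real.log (|(k : ℝ)| + 5))

/-- **The box of the closing argument**: with `σ_j = 1 + c_j log Λ/Λ` (`12 ≤ c₁ log Λ`,
`c₂ log Λ + 6 ≤ Λ/2`, `Λ ≥ 20`), every `s` of `modelBox Λ σ₁ σ₂` has `1 + 11/Λ ≤ Re s ≤ 3/2`,
`|Im s| ≤ 5/Λ` and `(c₁ log Λ − 1)/Λ ≤ |s − 1| ≤ (c₂ log Λ + 6)/Λ`. [cite: Montgomery1983, §4 (23)] -/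
theorem modelBox_basic {Λ c₁ c₂ : ℝ} (hΛ : 20 ≤ Λ) (hc₁ : 12 ≤ c₁ * Real.log Λ)
    (hc₂ : c₂ * Real.log Λ + 6 ≤ Λ / 2) {s : ℂ}
    (hs : s ∈ modelBox Λ (1 + c₁ * Real.log Λ / Λ) (1 + c₂ * Real.log Λ / Λ)) :
    1 + 11 / Λ ≤ s.re ∧ s.re ≤ 3 / 2 ∧ |s.im| ≤ 5 / Λ ∧
      (c₁ * Real.log Λ - 1) / Λ ≤ ‖s - 1‖ ∧ ‖s - 1‖ ≤ (c₂ * Real.log Λ + 6) / Λ ∧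
      (c₁ * Real.log Λ - 1) / Λ ≤ s.re - 1 := by
  have hΛ0 : 0 < Λ := by linarith
  obtain ⟨h1, h2, h3⟩ := hs
  have hre1 : (c₁ * Real.log Λ - 1) / Λ ≤ s.re - 1 := by
    have : 1 + c₁ * Real.log Λ / Λ - 1 / Λ = 1 + (c₁ * Real.log Λ - 1) / Λ := by ring
    linarith
  have hre2 : s.re - 1 ≤ (c₂ * Real.log Λ + 1) / Λ := by
    have : 1 + c₂ * Real.log Λ / Λ + 1 / Λ = 1 + (c₂ * Real.log Λ + 1) / Λ := by ring
    linarith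
  refine ⟨?_, ?_, h3.le, ?_, ?_, hre1⟩
  · have : 11 / Λ ≤ (c₁ * Real.log Λ - 1) / Λ := div_le_div_of_nonneg_right (by linarith) hΛ0.le
    linarith
  · have : (c₂ * Real.log Λ + 1) / Λ ≤ 1 / 2 := by
      rw [div_le_iff₀ hΛ0]; linarith
    linarith
  · have h0 : 0 ≤ (c₁ * Real.log Λ - 1) / Λ := div_nonneg (by linarith) hΛ0.le
    calc (c₁ * Real.log Λ - 1) / Λ ≤ s.re - 1 := hre1
      _ = |(s - 1).re| := by
          rw [sub_re, one_re, abs_of_nonneg]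
          linarith
      _ ≤ ‖s - 1‖ := abs_re_le_norm _
  · have h0 : 0 ≤ (c₁ * Real.log Λ - 1) / Λ := div_nonneg (by linarith) hΛ0.le
    calc ‖s - 1‖ ≤ |(s - 1).re| + |(s - 1).im| := norm_le_abs_re_add_abs_im _
      _ = (s.re - 1) + |s.im| := by
          rw [sub_re, one_re, sub_im, one_im, sub_zero, abs_of_nonneg]
          linarith
      _ ≤ (c₂ * Real.log Λ + 1) / Λ + 5 / Λ := add_le_add hre2 h3.le
      _ = (c₂ * Real.log Λ + 6) / Λ := by ring

include h18 in
/-- **`f` on the box**: `r₁ ≤ |f(s)| ≤ r₂` with `r₁ = ((c₁ log Λ − 1)/Λ)^{−b̂(0)} e^{−G₀}`,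
`r₂ = ((c₂ log Λ + 6)/Λ)^{−b̂(0)} e^{G₀}` (`G₀ = A₁ + A₂ log log 5`). [cite: Montgomery1983, Lemma 4 (18), §4 (25)] -/
theorem norm_montgomeryF_modelBox {Λ c₁ c₂ : ℝ} (hΛ : 20 ≤ Λ) (hc₁ : 12 ≤ c₁ * Real.log Λ)
    (hc₂ : c₂ * Real.log Λ + 6 ≤ Λ / 2) {s : ℂ}
    (hs : s ∈ modelBox Λ (1 + c₁ * Real.log Λ / Λ) (1 + c₂ * Real.log Λ / Λ)) :
    ((c₁ * Real.log Λ - 1) / Λ) ^ (-montgomeryCoeff m 0) * Real.exp (-(A₁ + A₂ * Real.log (Real.log 5))) ≤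
        ‖montgomeryF m s‖ ∧
      ‖montgomeryF m s‖ ≤
        ((c₂ * Real.log Λ + 6) / Λ) ^ (-montgomeryCoeff m 0) * Real.exp (A₁ + A₂ * Real.log (Real.log 5)) := by
  have hΛ0 : 0 < Λ := by linarith
  obtain ⟨hσ1, hσ2, ht, hn1, hn2, hre⟩ := modelBox_basic hΛ hc₁ hc₂ hs
  have hγ0 : 0 < -montgomeryCoeff m 0 := by linarith [(montgomeryCoeff_zero_bounds m).2]
  have hpos : 0 < (c₁ * Real.log Λ - 1) / Λ := div_pos (by linarith) hΛ0
  have ht' : |s.im| ≤ 1 / 2 := ht.trans (by rw [div_le_iff₀ hΛ0]; linarith)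
  obtain ⟨hup, hlow⟩ := norm_montgomeryF_near_one m h18 (by linarith [div_pos (show (0:ℝ) < 11 by norm_num) hΛ0])
    hσ2 ht'
  constructor
  · refine le_trans ?_ hlow
    exact mul_le_mul_of_nonneg_right (Real.rpow_le_rpow hpos.le hn1 hγ0.le) (Real.exp_pos _).le
  · refine hup.trans ?_
    exact mul_le_mul_of_nonneg_right (Real.rpow_le_rpow (norm_nonneg _) hn2 hγ0.le) (Real.exp_pos _).le

include h18 h19 in
/-- **`f'` on the box**: `|f'(s)| ≤ r₂ (−b̂(0) Λ/(c₁ log Λ − 1) + L₀)`, `L₀ = A₃ + A₄ log 5`.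
[cite: Montgomery1983, Lemma 4 (19)] -/
theorem norm_deriv_montgomeryF_modelBox {Λ c₁ c₂ : ℝ} (hΛ : 20 ≤ Λ) (hc₁ : 12 ≤ c₁ * Real.log Λ)
    (hc₁₂ : c₁ ≤ c₂) (hc₂ : c₂ * Real.log Λ + 6 ≤ Λ / 2) {s : ℂ}
    (hs : s ∈ modelBox Λ (1 + c₁ * Real.log Λ / Λ) (1 + c₂ * Real.log Λ / Λ)) :
    ‖deriv (montgomeryF m) s‖ ≤
      ((c₂ * Real.log Λ + 6) / Λ) ^ (-montgomeryCoeff m 0) * Real.exp (A₁ + A₂ * Real.log (Real.log 5)) *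
        ((-montgomeryCoeff m 0) * (Λ / (c₁ * Real.log Λ - 1)) + (A₃ + A₄ * Real.log 5)) := by
  have hΛ0 : 0 < Λ := by linarith
  obtain ⟨hσ1, hσ2, ht, hn1, hn2, hre⟩ := modelBox_basic hΛ hc₁ hc₂ hs
  have hγ0 : 0 < -montgomeryCoeff m 0 := by linarith [(montgomeryCoeff_zero_bounds m).2]
  have hpos : 0 < (c₁ * Real.log Λ - 1) / Λ := div_pos (by linarith) hΛ0
  have ht' : |s.im| ≤ 1 / 2 := ht.trans (by rw [div_le_iff₀ hΛ0]; linarith)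
  have hσ1' : 1 < s.re := by linarith [div_pos (show (0:ℝ) < 11 by norm_num) hΛ0]
  have hd := norm_deriv_montgomeryF_near_one m h19 hσ1' hσ2 ht'
  have hf := (norm_montgomeryF_modelBox m h18 hΛ hc₁ hc₂ hs).2
  have hL0 : 0 ≤ A₃ + A₄ * Real.log 5 := by
    have := h19 0 s hσ1' (by linarith) (by simpa using ht')
    exact le_trans (norm_nonneg _) (by simpa using this)
  have hlog0 : 0 < Real.log Λ := Real.log_pos (by linarith)
  have hc₂0 : 0 ≤ (c₂ * Real.log Λ + 6) / Λ := by
    refine div_nonneg ?_ hΛ0.le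
    have : c₁ * Real.log Λ ≤ c₂ * Real.log Λ := mul_le_mul_of_nonneg_right hc₁₂ hlog0.le
    linarith
  refine hd.trans (mul_le_mul hf (add_le_add ?_ le_rfl)
    (add_nonneg (div_nonneg hγ0.le (norm_nonneg _)) hL0) (mul_nonneg (Real.rpow_nonneg hc₂0 _) (Real.exp_pos _).le))
  rw [div_eq_mul_one_div]
  refine mul_le_mul_of_nonneg_left ?_ hγ0.le
  rw [one_div_le (lt_of_lt_of_le hpos hn1) (div_pos hΛ0 (by linarith)), one_div_div]
  exact hn1

include h18 in
/-- **The coefficient `a₀ = e^{iΛ} Λ^{β−1} g₁(0)/Γ(β)` of the model**: `a₀ ≠ 0` and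
`Λ^{β−1} e^{−G₁}/Γ(β) ≤ |a₀| ≤ Λ^{β−1} e^{G₁}/Γ(β)` (`G₁ = A₁ + A₂ log log 6`; "`1 ≪ |D₂| ≪ 1`").
[cite: Montgomery1983, §4 (24)] -/
theorem norm_aZero_bounds {Λ : ℝ} (hΛ : 2 ≤ Λ) :
    (exp ((Λ : ℂ) * I) * ((Λ ^ (montgomeryCoeff m 1 - 1) / Real.Gamma (montgomeryCoeff m 1) : ℝ) : ℂ) *
        gOne m Λ 0) ≠ 0 ∧
    Λ ^ (montgomeryCoeff m 1 - 1) / Real.Gamma (montgomeryCoeff m 1) * Real.exp (-(A₁ + A₂ * Real.log (Real.log 6))) ≤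
      ‖exp ((Λ : ℂ) * I) * ((Λ ^ (montgomeryCoeff m 1 - 1) / Real.Gamma (montgomeryCoeff m 1) : ℝ) : ℂ) *
        gOne m Λ 0‖ ∧
    ‖exp ((Λ : ℂ) * I) * ((Λ ^ (montgomeryCoeff m 1 - 1) / Real.Gamma (montgomeryCoeff m 1) : ℝ) : ℂ) *
        gOne m Λ 0‖ ≤
      Λ ^ (montgomeryCoeff m 1 - 1) / Real.Gamma (montgomeryCoeff m 1) * Real.exp (A₁ + A₂ * Real.log (Real.log 6)) := by
  have hΛ0 : 0 < Λ := by linarith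
  have hβ0 : 0 < montgomeryCoeff m 1 := by have := (montgomeryCoeff_one_bounds m).1; linarith
  have hΓ : 0 < Real.Gamma (montgomeryCoeff m 1) := Real.Gamma_pos_of_pos hβ0
  have hsc : 0 < Λ ^ (montgomeryCoeff m 1 - 1) / Real.Gamma (montgomeryCoeff m 1) :=
    div_pos (Real.rpow_pos_of_pos hΛ0 _) hΓ
  have hnorm : ‖exp ((Λ : ℂ) * I) * ((Λ ^ (montgomeryCoeff m 1 - 1) / Real.Gamma (montgomeryCoeff m 1) : ℝ) : ℂ) *
      gOne m Λ 0‖ = Λ ^ (montgomeryCoeff m 1 - 1) / Real.Gamma (montgomeryCoeff m 1) * ‖gOne m Λ 0‖ := by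
    rw [norm_mul, norm_mul, norm_exp_ofReal_mul_I, one_mul, norm_real, Real.norm_eq_abs, abs_of_pos hsc]
  obtain ⟨hg1, hg2⟩ := norm_gOne_le m h18 hΛ (v := 0) (by norm_num)
  refine ⟨?_, ?_, ?_⟩
  · rw [← norm_pos_iff, hnorm]
    exact mul_pos hsc (lt_of_lt_of_le (Real.exp_pos _) hg2)
  · rw [hnorm]; exact mul_le_mul_of_nonneg_left hg2 hsc.le
  · rw [hnorm]; exact mul_le_mul_of_nonneg_left hg1 hsc.le

end Box

end Model

end Literature.Barriers.RiemannHypothesis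

end
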